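import Literature.Probability.Percolation.PercolationEvents
import HarnessLib

/-!
# Long-range bond percolation on `ℤ`: blocks, crossings, bridges (deterministic part)

Topic `Literature/Probability/Percolation`. The configuration-wise (measure-free) combinatorics
behind the renormalisation proof of the Aizenman–Newman dichotomy `M = 0 ∨ β M² ≥ 1` for
one-dimensional `1/|x-y|²` models, in the form given by Duminil-Copin, Garban and Tassion
(*Long-range models in 1D revisited*, Ann. Inst. H. Poincaré Probab. Statist. 60 (2024),
arXiv:2011.04642, §2.4, proof of Thm. 1(ii) and Lemma 3): a block `[c - 3K, c + 3K]` is
*`K`-crossed* if some `x ≤ c - 3K` is joined to some `y ≥ c + 3K` by open edges of length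
`≤ K` inside the window `[c - 4K, c + 4K]`; if the big block at scale `CK` is `CK`-crossed then
every small block inside it is `K`-crossed unless an open *mid-range* edge (length in
`(K, CK]`) touches its extended window or a mid-range *bridge* (an open edge whose two
endpoints are, without using the edge itself, joined to distance `> R`) jumps over it
(`cross_subset_touched_union_jumpBridged_union_cross`, DGT's "all the `3K`-blocks in `B_{CK}`
must be either bridged or `K`-crossed").

## Contents

* generic walk lemmas for `SimpleGraph`: propagation of a vertex set closed along the edges of
  a walk (`SimpleGraph.Walk.mem_of_edges_closed`), transfer of a walk avoiding one edge to a
  graph containing all other edges (`SimpleGraph.Walk.reachable_of_forall_edges_ne`), and the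
  splitting of a path at one of its edges (`SimpleGraph.Walk.IsPath.split_at_edge`);
* `edgeLen e = |x - y|` for `e = s(x, y)`, with `omega`-friendly characterisations;
* the events (sets of configurations `ω : BondConfig ℤ = Set (Sym2 ℤ)`):
  `windowEdges K c` (edges of length `≤ K` inside `[c - 4K, c + 4K]`, a finite set),
  `cross K c` (the block centred at `c` is `K`-crossed inside its window; determined by
  `windowEdges K c`, increasing, measurable), `exits R ω x` (`x` is joined to distance `> R`),
  `IsLongBridge L R ω x y`, `touched K L R c`, `jumpBridged K L R c`;
* `cross_subset_touched_union_jumpBridged_union_cross` — the block lemma (DGT, proof of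
  Lemma 3, first display).

The locality of `exits`/bridges, the bridge decomposition behind DGT's estimate
`P[{x,y} bridge] ≤ p_{xy} θ²`, and the final-step lemma ("`B(K)` and no crossing of
`B^{±2}_{3K}` exclude `A(K)`") go to the forthcoming companions `LongRangeBridges.lean` /
`LongRangeEscape.lean`; the probabilistic half (Harris, independence, the `0`–`1` law) to
forthcoming `LongRangeModel.lean` … `Barriers/CriticalPhenomena/LongRangeDiscontinuityProofs.lean`.

Conventions: blocks are symmetric integer intervals around their centre, a crossing going from
`x ≤ c - 3K` to `y ≥ c + 3K` (DGT use half-open blocks `[K(i-1), K(i+1))`; immaterial); "DGT20"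
in the docstrings is the arXiv 2020 posting of [DuminilcopinGarbanTassion2024]; parameters
`K, L, R : ℕ`, sites `x, c : ℤ`. DGT's "bridged" ("there is a bridge `{x,y}` with
`K < y - x ≤ CK` and either `x < 3K(i+1)` or `y ≥ 3K(i-1)`", to be read with "and") is replaced
by the pair `touched ∪ jumpBridged`, which makes the decoupling step of Lemma 3 an exact
disjoint-support identity.

## References

* H. Duminil-Copin, C. Garban, V. Tassion, *Long-range models in 1D revisited*, Ann. Inst.
  H. Poincaré Probab. Statist. 60 (2024), arXiv:2011.04642: §2.4 (Thm. 1(ii), Lemma 3).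
* M. Aizenman, C. M. Newman, *Discontinuity of the percolation density in one-dimensional
  `1/|x-y|²` percolation models*, Comm. Math. Phys. 107 (1986) 611–647: Prop. 1.1.
-/

namespace SimpleGraph.Walk

variable {V : Type*} {G : SimpleGraph V}

/-- **Propagation along a walk.** If `u ∈ S` and `S` is closed along every edge of the walk
`w : u ⟶ v` (in both directions), then `v ∈ S`. (Deliberate dot-notation extension of
Mathlib's `SimpleGraph.Walk` namespace.) [folklore] -/
theorem mem_of_edges_closed {u v : V} (w : G.Walk u v) {S : Set V} (hu : u ∈ S)
    (hS : ∀ a b : V, s(a, b) ∈ w.edges → a ∈ S → b ∈ S) : v ∈ S := by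
  induction w with
  | nil => exact hu
  | @cons a b c h w ih =>
    refine ih (hS a b (by simp) hu) fun x y hxy hx => hS x y ?_ hx
    rw [edges_cons]
    exact List.mem_cons_of_mem _ hxy

/-- **Transfer of a walk avoiding an edge.** If every edge of `G` other than `e` is an edge of
`G'` and the walk `w` avoids `e`, then its endpoints are joined in `G'` (Mathlib anchors:
`SimpleGraph.Walk.mem_edges_of_not_reachable_deleteEdges` (contrapositive, with
`Reachable.mono` from `G.deleteEdges {e} ≤ G'`), `Walk.transfer`, `Walk.toDeleteEdges`;
dot-notation extension of `SimpleGraph.Walk`). [folklore] -/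
theorem reachable_of_forall_edges_ne {G' : SimpleGraph V} {e : Sym2 V}
    (hG' : ∀ a b : V, G.Adj a b → s(a, b) ≠ e → G'.Adj a b) {u v : V} (w : G.Walk u v)
    (hw : ∀ e' ∈ w.edges, e' ≠ e) : G'.Reachable u v := by
  induction w with
  | nil => exact Reachable.refl _
  | @cons a b c h w ih =>
    have hab : G'.Adj a b := hG' a b h (hw _ (by simp))
    refine hab.reachable.trans (ih fun e' he' => hw e' ?_)
    rw [edges_cons]
    exact List.mem_cons_of_mem _ he'

/-- **Splitting a path at one of its edges.** If the path `p : u ⟶ v` of `G` uses the edge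
`s(x, y)`, and `G'` contains every other edge of `G`, then in `G'` either `u ⟶ x` and
`y ⟶ v`, or `u ⟶ y` and `x ⟶ v` (the two pieces of the path avoid the edge, a path using each
edge once; Mathlib cousin: `SimpleGraph.Walk.IsTrail.not_mem_edges_of_not_reachable`).
(Dot-notation extension of `SimpleGraph.Walk.IsPath`.) [folklore] -/
theorem IsPath.split_at_edge {G' : SimpleGraph V} {x y : V}
    (hG' : ∀ a b : V, G.Adj a b → s(a, b) ≠ s(x, y) → G'.Adj a b) :
    ∀ {u v : V} (p : G.Walk u v), p.IsPath → s(x, y) ∈ p.edges →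
      (G'.Reachable u x ∧ G'.Reachable y v) ∨ (G'.Reachable u y ∧ G'.Reachable x v) := by
  intro u v p
  induction p with
  | nil => intro _ h; simp at h
  | @cons a b c h p ih =>
    intro hp he
    rw [cons_isPath_iff] at hp
    rw [edges_cons, List.mem_cons] at he
    -- the tail `p : b ⟶ c` avoids every edge at `a`, in particular `s(a, b)`
    have htail : ∀ e' ∈ p.edges, e' ≠ s(a, b) := by
      rintro e' he' rfl
      exact hp.2 (p.fst_mem_support_of_mem_edges he')
    rcases he with he | he
    · -- the edge is the first one: `{x, y} = {a, b}`
      have hG'' : ∀ a' b' : V, G.Adj a' b' → s(a', b') ≠ s(a, b) → G'.Adj a' b' := by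
        intro a' b' h1 h2; exact hG' a' b' h1 (he ▸ h2)
      have hbc : G'.Reachable b c := p.reachable_of_forall_edges_ne hG'' htail
      rcases Sym2.eq_iff.1 he with ⟨rfl, rfl⟩ | ⟨rfl, rfl⟩
      · exact Or.inl ⟨Reachable.refl _, hbc⟩
      · exact Or.inr ⟨Reachable.refl _, hbc⟩
    · -- the edge is in the tail: use the induction hypothesis and prepend `a ~ b` in `G'`
      have hne : s(a, b) ≠ s(x, y) := fun h' => htail _ he h'.symm
      have hab : G'.Reachable a b := (hG' a b h hne).reachable
      rcases ih hp.1 he with ⟨h1, h2⟩ | ⟨h1, h2⟩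
      · exact Or.inl ⟨hab.trans h1, h2⟩
      · exact Or.inr ⟨hab.trans h1, h2⟩

end SimpleGraph.Walk

namespace Literature.Probability.Percolation

open SimpleGraph

/-! ### Edge lengths on `ℤ` -/

/-- The length `|x - y|` of the bond `{x, y}` of `ℤ`. [cite: AizenmanNewman1986, §1 (1.1)] -/
def edgeLen : Sym2 ℤ → ℕ :=
  Sym2.lift ⟨fun x y : ℤ => (x - y).natAbs, fun x y => by
    show (x - y).natAbs = (y - x).natAbs
    rw [← Int.natAbs_neg, neg_sub]⟩

/-- `edgeLen s(x, y) = |x - y|`. [folklore] -/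
@[simp] theorem edgeLen_mk (x y : ℤ) : edgeLen s(x, y) = (x - y).natAbs := rfl

/-- `omega`-friendly form of `edgeLen s(x, y) ≤ K`. [folklore] -/
theorem edgeLen_mk_le_iff (x y : ℤ) (K : ℕ) :
    edgeLen s(x, y) ≤ K ↔ x - y ≤ K ∧ y - x ≤ K := by
  rw [edgeLen_mk]; omega

/-- `omega`-friendly form of `K < edgeLen s(x, y)`. [folklore] -/
theorem lt_edgeLen_mk_iff (x y : ℤ) (K : ℕ) :
    K < edgeLen s(x, y) ↔ (K : ℤ) < x - y ∨ (K : ℤ) < y - x := by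
  rw [edgeLen_mk]; omega

/-! ### Windows, crossings, exits, bridges -/

/-- The edges of length `≤ K` with both endpoints in the window `[c - 4K, c + 4K]` of the block
centred at `c` (DGT20, §2.4: "`x` is connected to `y` using open edges of length at most `K`";
we localise to the window, which is what the block lemma produces and all that is used).
[cite: DuminilcopinGarbanTassion2024, §2.4 (K-crossed blocks)] -/
def windowEdges (K : ℕ) (c : ℤ) : Set (Sym2 ℤ) :=
  {e | edgeLen e ≤ K ∧ ∀ z ∈ e, c - 4 * K ≤ z ∧ z ≤ c + 4 * K}

/-- Membership of a concrete edge in the window. [folklore] -/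
theorem mk_mem_windowEdges_iff (K : ℕ) (c x y : ℤ) :
    s(x, y) ∈ windowEdges K c ↔ (x - y ≤ K ∧ y - x ≤ K) ∧
      (c - 4 * K ≤ x ∧ x ≤ c + 4 * K) ∧ (c - 4 * K ≤ y ∧ y ≤ c + 4 * K) := by
  simp only [windowEdges, Set.mem_setOf_eq, Sym2.mem_iff, forall_eq_or_imp, forall_eq,
    edgeLen_mk_le_iff]

/-- The window edge set is finite (it injects into `[c-4K, c+4K]²`). [folklore] -/
theorem windowEdges_finite (K : ℕ) (c : ℤ) : (windowEdges K c).Finite := by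
  refine ((Set.finite_Icc (c - 4 * K) (c + 4 * K)).prod
    (Set.finite_Icc (c - 4 * K) (c + 4 * K))).image (fun p : ℤ × ℤ => s(p.1, p.2)) |>.subset ?_
  rintro e ⟨-, he⟩
  induction e using Sym2.ind with
  | h x y =>
    exact ⟨(x, y), ⟨⟨(he x (by simp)).1, (he x (by simp)).2⟩, ⟨(he y (by simp)).1,
      (he y (by simp)).2⟩⟩, rfl⟩

/-- **The block centred at `c` is `K`-crossed** (DGT20, §2.4): some `x ≤ c - 3K` is joined to
some `y ≥ c + 3K` by open edges of length `≤ K` lying in the window `[c - 4K, c + 4K]`.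
Intended for `K ≥ 1`; junk value `cross 0 c = univ` (`x = y = c`, empty path), see `cross_zero`.
[cite: DuminilcopinGarbanTassion2024, §2.4 (definition of K-crossed)] -/
def cross (K : ℕ) (c : ℤ) : Set (BondConfig ℤ) :=
  {ω | ∃ x y : ℤ, x ≤ c - 3 * K ∧ c + 3 * K ≤ y ∧ (openGraph (ω ∩ windowEdges K c)).Reachable x y}

/-- Junk value at scale `0`: every configuration is `0`-crossed (take `x = y = c`). [folklore] -/
theorem cross_zero (c : ℤ) : cross 0 c = Set.univ :=
  Set.eq_univ_of_forall fun _ => ⟨c, c, by simp, by simp, SimpleGraph.Reachable.refl _⟩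

/-- `cross K c` is determined by the (finite) window edge set. [folklore] -/
theorem determinedBy_cross (K : ℕ) (c : ℤ) : DeterminedBy (cross K c) (windowEdges K c) := by
  rw [determinedBy_iff]
  intro ω ω' h
  simp only [cross, Set.mem_setOf_eq, h]

/-- `cross K c` is an increasing event. [folklore] -/
theorem isUpperSet_cross (K : ℕ) (c : ℤ) : IsUpperSet (cross K c) := by
  rintro ω ω' hle ⟨x, y, hx, hy, hr⟩
  exact ⟨x, y, hx, hy, hr.mono (openGraph_mono (Set.inter_subset_inter_left _ hle))⟩

/-- `cross K c` is measurable (determined by finitely many edges). [folklore] -/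
theorem measurableSet_cross (K : ℕ) (c : ℤ) : MeasurableSet (cross K c) := by
  have h := determinedBy_cross K c
  rw [← (windowEdges_finite K c).coe_toFinset] at h
  exact h.measurableSet_of_finset

/-- **`x` exits its `R`-ball in `ω`**: `x` is joined by an open path of `ω` to a site at distance
`> R` (DGT20, §2.4: "connected to distance `R`"; DGT use the half-open ball `[x - R, x + R)`,
we use the symmetric closed ball `[x - R, x + R]` and strict exit distance `> R` — a sub-event,
immaterial since `R` is only sent to infinity).
[cite: DuminilcopinGarbanTassion2024, §2.4 (bridges)] -/
def exits (R : ℕ) (ω : BondConfig ℤ) (x : ℤ) : Prop :=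
  ∃ z : ℤ, ((R : ℤ) < z - x ∨ (R : ℤ) < x - z) ∧ (openGraph ω).Reachable x z

/-- `exits` is monotone in the configuration. [folklore] -/
theorem exits_mono {R : ℕ} {ω ω' : BondConfig ℤ} (h : ω ⊆ ω') {x : ℤ} (hx : exits R ω x) :
    exits R ω' x := by
  obtain ⟨z, hz, hr⟩ := hx
  exact ⟨z, hz, hr.mono (openGraph_mono h)⟩

/-- **Bridge** (DGT20, §2.4: "`{x,y}` is a bridge if it is open and in `ω ∖ {x,y}`, both `x`
and `y` are connected to distance `R`"): the edge `{x, y}` is open and, in the configuration of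
open edges of length `≤ L` with `{x, y}` itself removed, both `x` and `y` exit their `R`-balls.
Deviation from the printed definition: DGT's bridge has no length restriction on the two exit
paths; ours is the sub-event with exits through edges of length `≤ L` (`= CK` in Lemma 3),
which is all the block lemma produces (a crossing path only has edges of length `≤ CK`) and
only improves the bridge bound. Named `IsLongBridge` to keep clear of Mathlib's
`SimpleGraph.IsBridge` (this file opens `SimpleGraph`).
[cite: DuminilcopinGarbanTassion2024, §2.4 (definition of a bridge)] -/
def IsLongBridge (L R : ℕ) (ω : BondConfig ℤ) (x y : ℤ) : Prop :=
  s(x, y) ∈ ω ∧ exits R ((ω ∩ {e | edgeLen e ≤ L}) \ {s(x, y)}) x ∧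
    exits R ((ω ∩ {e | edgeLen e ≤ L}) \ {s(x, y)}) y

/-- **The extended window of the block at `c` is touched**: some open edge of length in
`(K, L]` ("mid-range") has an endpoint within distance `4K + R` of `c`.
[cite: DuminilcopinGarbanTassion2024, §2.4 (proof of Lemma 3)] -/
def touched (K L R : ℕ) (c : ℤ) : Set (BondConfig ℤ) :=
  {ω | ∃ e ∈ ω, K < edgeLen e ∧ edgeLen e ≤ L ∧
    ∃ z ∈ e, c - (4 * K + R) ≤ z ∧ z ≤ c + (4 * K + R)}

/-- **A mid-range bridge jumps over the extended window of the block at `c`.**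
[cite: DuminilcopinGarbanTassion2024, §2.4 (bridged blocks)] -/
def jumpBridged (K L R : ℕ) (c : ℤ) : Set (BondConfig ℤ) :=
  {ω | ∃ x y : ℤ, x < c - (4 * K + R) ∧ c + (4 * K + R) < y ∧ y - x ≤ L ∧ IsLongBridge L R ω x y}

/-! ### The block lemma -/

/-- **Block lemma** (DGT20, §2.4, proof of Lemma 3: "Assume that the block `B_{3CK}` is
`CK`-crossed, then all of the `3K`-blocks in `B_{CK}` must be either bridged or `K`-crossed").
Our rendering: if the block of scale `C K` centred at `c` is crossed, then for every centre `c'`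
with `[c' - 5K, c' + 5K] ⊆ [c - CK, c + CK]` and every `R` (the companions use `R ≤ K`), either
an open edge of length in `(K, CK]` touches `[c' - 4K - R, c' + 4K + R]`, or a bridge of length in
`(K, CK]` jumps over that interval, or the block of scale `K` centred at `c'` is crossed. Proof:
follow a crossing PATH; a jump edge over the extended window would be a bridge (its two sides
reach the far endpoints of the path without the edge, `IsPath.split_at_edge`); otherwise the set
`{z ≤ c' - 3K} ∪ {z < c' + 3K joined to (-∞, c' - 3K] inside the small window}` is closed along
the path (`Walk.mem_of_edges_closed`), contradicting that the path ends beyond `c + 3CK`.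
[cite: DuminilcopinGarbanTassion2024, §2.4 (proof of Lemma 3)] -/
theorem cross_subset_touched_union_jumpBridged_union_cross {K C R : ℕ} (hK : 1 ≤ K)
    {c c' : ℤ} (hc₁ : c - C * K + 5 * K ≤ c') (hc₂ : c' + 5 * K ≤ c + C * K) :
    cross (C * K) c ⊆ touched K (C * K) R c' ∪ jumpBridged K (C * K) R c' ∪ cross K c' := by
  classical
  intro ω hω
  by_contra hnot
  simp only [Set.mem_union, not_or] at hnot
  obtain ⟨⟨hT, hJ⟩, hX⟩ := hnot
  obtain ⟨x₀, y₀, hx₀, hy₀, hreach⟩ := hω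
  have hC : (1 : ℤ) ≤ C := by
    -- the big window contains `[c' - 5K, c' + 5K]`, so `C K ≥ 5 K > 0`
    have : (5 : ℤ) * K ≤ C * K := by linarith
    by_contra h
    push Not at h
    have hC0 : (C : ℤ) ≤ 0 := by omega
    nlinarith
  set G := openGraph (ω ∩ windowEdges (C * K) c) with hG
  obtain ⟨p, hp⟩ : ∃ p : G.Walk x₀ y₀, p.IsPath := ⟨hreach.some.bypass, hreach.some.bypass_isPath⟩
  -- facts about the edges of `p`
  have hedge : ∀ a b : ℤ, s(a, b) ∈ p.edges →
      s(a, b) ∈ ω ∧ (a - b ≤ ↑(C * K) ∧ b - a ≤ ↑(C * K)) := by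
    intro a b hab
    have hadj := p.adj_of_mem_edges hab
    rw [hG, openGraph_adj] at hadj
    obtain ⟨⟨hω', hw⟩, -⟩ := hadj
    exact ⟨hω', ((mk_mem_windowEdges_iff _ _ _ _).1 hw).1⟩
  -- the open edges of length `≤ CK` minus one edge contain every other edge of `G`
  have hG' : ∀ x y : ℤ, ∀ a b : ℤ, G.Adj a b → s(a, b) ≠ s(x, y) →
      (openGraph ((ω ∩ {e | edgeLen e ≤ C * K}) \ {s(x, y)})).Adj a b := by
    intro x y a b hab hne
    rw [hG, openGraph_adj] at hab
    rw [openGraph_adj]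
    refine ⟨⟨⟨hab.1.1, ?_⟩, hne⟩, hab.2⟩
    exact hab.1.2.1
  -- Step 1: no edge of the path jumps over the extended window (it would be a bridge)
  have hnojump : ∀ a b : ℤ, s(a, b) ∈ p.edges →
      ¬ (a < c' - (4 * K + R) ∧ c' + (4 * K + R) < b) := by
    rintro a b hab ⟨ha, hb⟩
    obtain ⟨habω, hlen⟩ := hedge a b hab
    refine hJ ⟨a, b, ha, hb, by push_cast at hlen ⊢; omega, habω, ?_⟩
    -- both endpoints exit their `R`-balls without the edge: they reach `x₀` or `y₀`
    have far : ∀ z : ℤ, (z = a ∨ z = b) → ∀ t : ℤ, (t = x₀ ∨ t = y₀) →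
        ((R : ℤ) < t - z ∨ (R : ℤ) < z - t) := by
      intro z hz t ht
      push_cast at hlen
      rcases hz with rfl | rfl <;> rcases ht with rfl | rfl <;> omega
    rcases hp.split_at_edge (hG' a b) p hab with ⟨h1, h2⟩ | ⟨h1, h2⟩
    · exact ⟨⟨x₀, far a (Or.inl rfl) x₀ (Or.inl rfl), h1.symm⟩,
        ⟨y₀, far b (Or.inr rfl) y₀ (Or.inr rfl), h2⟩⟩
    · exact ⟨⟨y₀, far a (Or.inl rfl) y₀ (Or.inr rfl), h2⟩,
        ⟨x₀, far b (Or.inr rfl) x₀ (Or.inl rfl), h1.symm⟩⟩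
  -- Step 2: no mid-range edge of the path has an endpoint in the extended window
  have hnotouch : ∀ a b : ℤ, s(a, b) ∈ p.edges → (K : ℤ) < b - a →
      ¬ (c' - (4 * K + R) ≤ a ∧ a ≤ c' + (4 * K + R)) ∧
      ¬ (c' - (4 * K + R) ≤ b ∧ b ≤ c' + (4 * K + R)) := by
    intro a b hab hlt
    obtain ⟨habω, hlen⟩ := hedge a b hab
    have hmid : K < edgeLen s(a, b) ∧ edgeLen s(a, b) ≤ C * K := by
      rw [lt_edgeLen_mk_iff, edgeLen_mk_le_iff]; exact ⟨Or.inr hlt, hlen⟩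
    constructor
    · rintro ⟨h1, h2⟩
      exact hT ⟨s(a, b), habω, hmid.1, hmid.2, a, by simp, h1, h2⟩
    · rintro ⟨h1, h2⟩
      exact hT ⟨s(a, b), habω, hmid.1, hmid.2, b, by simp, h1, h2⟩
  -- Step 3: the closed set
  set H := openGraph (ω ∩ windowEdges K c') with hH
  set Lft : Set ℤ := {z | z ≤ c' - 3 * K} ∪
    {z | z < c' + 3 * K ∧ ∃ x : ℤ, x ≤ c' - 3 * K ∧ H.Reachable x z} with hLft
  have hHadj : ∀ a b : ℤ, s(a, b) ∈ ω → a ≠ b → (a - b ≤ K ∧ b - a ≤ K) →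
      (c' - 4 * K ≤ a ∧ a ≤ c' + 4 * K) → (c' - 4 * K ≤ b ∧ b ≤ c' + 4 * K) → H.Adj a b := by
    intro a b h1 h2 h3 h4 h5
    rw [hH, openGraph_adj]
    exact ⟨⟨h1, (mk_mem_windowEdges_iff _ _ _ _).2 ⟨h3, h4, h5⟩⟩, h2⟩
  -- closure along one oriented edge `a → b` of the path
  have hCK : (0 : ℤ) ≤ C * K := by positivity
  have hclosed : ∀ a b : ℤ, s(a, b) ∈ p.edges → a ∈ Lft → b ∈ Lft := by
    intro a b hab ha0
    have ha : a ≤ c' - 3 * K ∨ (a < c' + 3 * K ∧ ∃ x : ℤ, x ≤ c' - 3 * K ∧ H.Reachable x a) :=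
      ha0
    obtain ⟨habω, hlen⟩ := hedge a b hab
    have hne : a ≠ b := (p.adj_of_mem_edges hab).ne
    push_cast at hlen
    by_cases hshort : a - b ≤ K ∧ b - a ≤ K
    · -- short edge
      -- if `b ≤ c' - 3K` we are done
      by_cases hb1 : b ≤ c' - 3 * K
      · exact Or.inl hb1
      push Not at hb1
      -- otherwise the edge lies in the small window and `b` is reached from the left
      have hreachb : ∃ x : ℤ, x ≤ c' - 3 * K ∧ H.Reachable x b := by
        rcases ha with ha1 | ⟨ha2, x, hx, hxa⟩
        · refine ⟨a, ha1, (hHadj a b habω hne hshort ?_ ?_).reachable⟩ <;> omega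
        · refine ⟨x, hx, hxa.trans (hHadj a b habω hne hshort ?_ ?_).reachable⟩ <;> omega
      by_cases hb2 : b < c' + 3 * K
      · exact Or.inr ⟨hb2, hreachb⟩
      · -- `b ≥ c' + 3K`: the small block is crossed, contradiction
        push Not at hb2
        obtain ⟨x, hx, hxb⟩ := hreachb
        exact absurd ⟨x, b, hx, hb2, hxb⟩ hX
    · -- mid-range edge: both endpoints avoid the extended window and it does not jump
      have hlt : (K : ℤ) < b - a ∨ (K : ℤ) < a - b := by omega
      have haLt : a < c' + 3 * K := by
        rcases ha with ha1 | ⟨ha2, -⟩ <;> omega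
      rcases hlt with hlt | hlt
      · obtain ⟨hna, hnb⟩ := hnotouch a b hab hlt
        have hj := hnojump a b hab
        left
        show b ≤ c' - 3 * K
        omega
      · have hba : s(b, a) ∈ p.edges := by rw [Sym2.eq_swap]; exact hab
        obtain ⟨hnb, hna⟩ := hnotouch b a hba hlt
        left
        show b ≤ c' - 3 * K
        omega
  have hx₀L : x₀ ∈ Lft := by
    refine Or.inl ?_
    show x₀ ≤ c' - 3 * K
    push_cast at hx₀
    nlinarith
  have hy₀L : y₀ ∈ Lft := p.mem_of_edges_closed (S := Lft) hx₀L hclosed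
  have hy₀' : y₀ < c' + 3 * K := by
    rcases hy₀L with h | ⟨h, -⟩
    · have h' : y₀ ≤ c' - 3 * K := h
      have hK0 : (0 : ℤ) ≤ K := by positivity
      linarith
    · exact h
  push_cast at hy₀
  nlinarith

end Literature.Probability.Percolation
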